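import Literature.Geometry.Riemannian.RicciFlowChartCovariantBounds
import Literature.Geometry.Lorentzian.CoordScaledMetricIdentities
import HarnessLib

/-!
# Bounds on all derivatives of the scaled metric `G/(T − t)` in a chart; Cauchy property as `t ↑ T`
(topic `Geometry/Riemannian`)

Companion of `RicciFlowChartCovariantBounds.lean` for the NORMALISED Ricci flow near a round
singular time (Hamilton 1982, §14, Lemma 14.2; §17, Thm. 17.6 / Cor. 17.10: in charts the metrics
`g̃(t) = g(t)/(T − t)` have bounded coordinate derivatives of all orders, converging uniformly as
`t ↑ T`). PROVED here in coordinates from the data the geometric estimates deliver on a chart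
cylinder `B(y₀, r') × (t₁, T)`: `λ|v|² ≤ G̃(v,v)`, `‖G̃‖ ≤ Λ`, the decay
`‖Ric(G) − G/(2(T − t))‖ ≤ C₀(T − t)^{δ₀}` of the Einstein defect and the decay
`|(∇ᵏ⁺¹Ric)_I| ≤ C_k(T − t)^{δ_k}` of the components of the covariant Ricci derivatives.

* `MetricCoord.spatiallyBddUpTo_scaled_of_covariantRicciDecay` — for every order `N` the spatial
  derivatives of order `≤ N` of `G̃` and of the weighted defect components
  `(T − t)^{−ε}(Ric(G) − G/(2(T − t)))_{ab}` (some `ε > 0`) are bounded: the induction of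
  `spatiallyBddUpTo_metric_of_covariantRicciBounds` (Chow–Knopf 2004, §6.7) re-run with DECAY
  WEIGHTS, for `G̃`, `G̃⁻¹ = (T − t)G⁻¹`, `Γ` (scale invariant; `∂ₜΓ = −g⁻¹ * ∇Ric` has the
  INTEGRABLE rate `(T − t)^{ε−1}`, `spatiallyBddUpTo_of_dT_rpow`), `(T − t)^{−ε}(∇ᵏ⁺¹Ric)_I` and
  the weighted defect (`∂_j D_I = (∇Ric)_{jI} + ΣΓD` as `∇g = 0`).
The consequence — every `∂ᵐ_y G̃(·, t)` is bounded on the cylinder and uniformly Cauchy as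
`t ↑ T` (the scaled flow equation has right-hand side `(T − t)^{ε−1}·(bounded up to order m)`) —
and its manifold form are in `RicciFlowScaledChartCauchy.lean`. No named fact is introduced;
everything in this file is proved.

## References

* R. S. Hamilton, *Three-manifolds with positive Ricci curvature*, J. Differential Geom. 17
  (1982) 255–306, §14, Lemma 14.2; §17, Thm. 17.6, Cor. 17.10. [Hamilton1982]
* B. Chow, D. Knopf, *The Ricci flow: an introduction*, AMS 2004, §6.7. [ChowKnopf2004]
* P. Topping, *Lectures on the Ricci flow*, LMS Lecture Note Series 325, CUP 2006, proof of
  Thm. 5.3.1, pp. 47–48; Prop. 2.3.1. [Topping2006]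
-/

noncomputable section

set_option maxSynthPendingDepth 3

open Bundle Set Filter Function Metric Real Module
open scoped Manifold ContDiff Topology

namespace Literature.Geometry.Lorentzian

namespace MetricCoord

open Literature.Analysis.Calculus

universe u

variable {E : Type u} [NormedAddCommGroup E] [NormedSpace ℝ E] [FiniteDimensional ℝ E] [CompleteSpace E]
  {ι : Type*} [Fintype ι]

/-- **Bounds on all spatial derivatives of the scaled metric `G̃ = G/(T − t)` from the decay of
the Einstein defect and of the covariant Ricci derivatives** (Hamilton 1982, §14, Lemma 14.2 and
§17, Cor. 17.10, in the inductive form of Chow–Knopf 2004, §6.7 with decay weights). Let `G` be a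
smooth family of metric components on `V × [0, T)` solving `∂ₜG = −2 Ric(G)`; on the cylinder
`Ω = B(y₀, r') × (t₁, T)`, `B̄(y₀, r') ⊆ B(y₀, r) ⊆ V`, suppose `‖G̃‖ ≤ Λ`, `G̃(v,v) ≥ λ|v|²`
(`λ > 0`), `‖Ric(G) − G/(2(T−t))‖ ≤ C₀ (T−t)^{δ₀}` and, for every `k`, all components of
`∇ᵏ⁺¹Ric` bounded by `C_k (T − t)^{δ_k}` (`δ₀, δ_k > 0`). Then for every order `N` the spatial
derivatives of `G̃` of order `≤ N` are bounded on `Ω`, and so are those of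
`(T − t)^{−ε} (Ric(G) − G/(2(T−t)))_{ab}` for some `ε > 0`. Induction on the order `n ≤ N`,
simultaneously for `G̃`, `G̃⁻¹`, the Christoffel symbols `Γ` (integrating
`∂ₜΓ = −g⁻¹ * ∇Ric = (T−t)^{ε−1} · (bounded)` in time, `spatiallyBddUpTo_of_dT_rpow`), the weighted
`(T−t)^{−ε}(∇ᵏ⁺¹Ric)_I` (`∂_j(∇ᵏRic)_I = (∇ᵏ⁺¹Ric)_{jI} + ΣΓ(∇ᵏRic)`) and the weighted defect
(`∂_j D_I = (∇Ric)_{jI} + ΣΓ D`), with `∂_i g̃_{jl} = Σ(Γg̃ + Γg̃)`.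
[cite: Hamilton1982, §14, Lemma 14.2] [cite: Hamilton1982, §17, Cor. 17.10]
[cite: ChowKnopf2004, §6.7] -/
theorem spatiallyBddUpTo_scaled_of_covariantRicciDecay (b : Basis ι ℝ E)
    {G : ℝ → E → E →L[ℝ] E →L[ℝ] ℝ} {V : Set E} {T : ℝ}
    (hfam : IsMetricFamilyOn G (Ico 0 T) V)
    (hfl : ∀ t ∈ Ico 0 T, ∀ y ∈ V, tDeriv G (Ico 0 T) t y = (-2 : ℝ) • ricAt (G t) y)
    {y₀ : E} {r r' : ℝ} (hr'r : r' < r) (hball : ball y₀ r ⊆ V) {t₁ : ℝ} (ht₁ : t₁ ∈ Ico 0 T)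
    {Λ lam : ℝ} (hlam : 0 < lam)
    (hΛ : ∀ q ∈ ball y₀ r' ×ˢ Ioo t₁ T, ‖(T - q.2)⁻¹ • G q.2 q.1‖ ≤ Λ)
    (hpos : ∀ q ∈ ball y₀ r' ×ˢ Ioo t₁ T, ∀ v : E, lam * ‖v‖ ^ 2 ≤ (T - q.2)⁻¹ * G q.2 q.1 v v)
    {δ₀ C₀ : ℝ} (hδ₀ : 0 < δ₀)
    (hD : ∀ q ∈ ball y₀ r' ×ˢ Ioo t₁ T,
      ‖ricAt (G q.2) q.1 - (2 * (T - q.2))⁻¹ • G q.2 q.1‖ ≤ C₀ * (T - q.2) ^ δ₀)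
    (hcov : ∀ k : ℕ, ∃ δ C : ℝ, 0 < δ ∧ ∀ q ∈ ball y₀ r' ×ˢ Ioo t₁ T,
      ∀ I : Fin (k + 1) ⊕ Fin 2 → ι,
        |tcovIter (G q.2) b (k + 1) (ric2 (G q.2) b) q.1 I| ≤ C * (T - q.2) ^ δ)
    (N : ℕ) :
    ∃ ε : ℝ, 0 < ε ∧
      SpatiallyBddUpTo (ball y₀ r' ×ˢ Ioo t₁ T) N (fun q : E × ℝ ↦ (T - q.2)⁻¹ • G q.2 q.1) ∧
      ∀ I : Fin 2 → ι, SpatiallyBddUpTo (ball y₀ r' ×ˢ Ioo t₁ T) N (fun q : E × ℝ ↦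
        (T - q.2) ^ (-ε) •
          (ric2 (G q.2) b q.1 I - (2 * (T - q.2))⁻¹ * G q.2 q.1 (b (I 0)) (b (I 1)))) := by
  classical
  -- the cylinders
  have hB : IsOpen (ball y₀ r') := isOpen_ball
  have hB₀ : IsOpen (ball y₀ r) := isOpen_ball
  have hΩ : IsOpen (ball y₀ r' ×ˢ Ioo t₁ T) := hB.prod isOpen_Ioo
  have hΩ₀ : IsOpen (ball y₀ r ×ˢ Ioo t₁ T) := hB₀.prod isOpen_Ioo
  have hBB₀ : ball y₀ r' ⊆ ball y₀ r := ball_subset_ball hr'r.le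
  have hcB : closedBall y₀ r' ⊆ ball y₀ r := closedBall_subset_ball hr'r
  have hΩΩ₀ : ball y₀ r' ×ˢ Ioo t₁ T ⊆ ball y₀ r ×ˢ Ioo t₁ T := prod_mono hBB₀ Subset.rfl
  have hIT : Ioo t₁ T ⊆ Ico 0 T := fun t ht ↦ ⟨ht₁.1.trans ht.1.le, ht.2⟩
  have hΩ₀V : ball y₀ r ×ˢ Ioo t₁ T ⊆ V ×ˢ Ico 0 T := prod_mono hball hIT
  have htime : ∀ q ∈ ball y₀ r' ×ˢ Ioo t₁ T, q.2 ∈ Ioo t₁ T := fun q hq ↦ hq.2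
  have hmet : ∀ q ∈ ball y₀ r' ×ˢ Ioo t₁ T, IsMetricOn (G q.2) V := fun q hq ↦
    hfam.isMetricOn q.2 (hIT hq.2)
  have hyV : ∀ q ∈ ball y₀ r' ×ˢ Ioo t₁ T, q.1 ∈ V := fun q hq ↦ hball (hBB₀ hq.1)
  have hh : ∀ q ∈ ball y₀ r' ×ˢ Ioo t₁ T, 0 < T - q.2 := fun q hq ↦ sub_pos.2 hq.2.2
  -- the component functions: scaled metric, Christoffel symbols, scaled inverse, `∇ᵏ⁺¹Ric`, defect
  set Ω : Set (E × ℝ) := ball y₀ r' ×ˢ Ioo t₁ T with hΩdef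
  set uG : E × ℝ → (E →L[ℝ] E →L[ℝ] ℝ) := fun q ↦ (T - q.2)⁻¹ • G q.2 q.1 with huGdef
  set Γc : ι → ι → ι → E × ℝ → ℝ := fun j i m q ↦ chrCoef (G q.2) b q.1 j i m with hΓc
  set gi : ι → ι → E × ℝ → ℝ := fun i j q ↦ coordCLM b i ((uG q).inverse (coordCLM b j)) with hgi
  set Rc : (k : ℕ) → (Fin (k + 1) ⊕ Fin 2 → ι) → E × ℝ → ℝ :=
    fun k I q ↦ tcovIter (G q.2) b (k + 1) (ric2 (G q.2) b) q.1 I with hRc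
  set Dc : (Fin 2 → ι) → E × ℝ → ℝ := fun I q ↦
    ric2 (G q.2) b q.1 I - (2 * (T - q.2))⁻¹ * G q.2 q.1 (b (I 0)) (b (I 1)) with hDc
  -- joint smoothness on the larger cylinder
  have hsmG₀ : ContDiffOn ℝ ∞ (fun q : E × ℝ ↦ G q.2 q.1) (ball y₀ r ×ˢ Ioo t₁ T) :=
    hfam.contDiffOn.mono hΩ₀V
  have hsminv : ContDiffOn ℝ ∞ (fun q : E × ℝ ↦ (T - q.2)⁻¹) (ball y₀ r ×ˢ Ioo t₁ T) :=
    (contDiffOn_const.sub contDiffOn_snd).inv fun q hq ↦ sub_ne_zero.2 (ne_of_gt hq.2.2)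
  have hsmG : ContDiffOn ℝ ∞ uG (ball y₀ r ×ˢ Ioo t₁ T) := hsminv.smul hsmG₀
  have hsmΓ : ∀ j i m, ContDiffOn ℝ ∞ (Γc j i m) (ball y₀ r ×ˢ Ioo t₁ T) := fun j i m ↦
    (hfam.contDiffOn_chrCoef_family b j i m).mono hΩ₀V
  have hsmR : ∀ k I, ContDiffOn ℝ ∞ (Rc k I) (ball y₀ r ×ˢ Ioo t₁ T) := fun k I ↦
    (hfam.contDiffOn_tcovIter_ric2_family b (k + 1) I).mono hΩ₀V
  have hsmD : ∀ I, ContDiffOn ℝ ∞ (Dc I) (ball y₀ r ×ˢ Ioo t₁ T) := fun I ↦ by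
    refine ((hfam.tsmoothFamOn_ric2 b I).mono hΩ₀V).sub ?_
    refine ((contDiffOn_const.mul (contDiffOn_const.sub contDiffOn_snd)).inv ?_).mul
      ((hsmG₀.clm_apply contDiffOn_const).clm_apply contDiffOn_const)
    exact fun q hq ↦ mul_ne_zero two_ne_zero (sub_ne_zero.2 (ne_of_gt hq.2.2))
  -- the compact set of values of `G̃`, and the inverse
  set K₁ : Set (E →L[ℝ] E →L[ℝ] ℝ) := {A | ∀ v : E, lam * ‖v‖ ^ 2 ≤ A v v} ∩ closedBall 0 Λ
    with hK₁def
  have hK₁ : IsCompact K₁ := by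
    haveI : FiniteDimensional ℝ (E →L[ℝ] E →L[ℝ] ℝ) := ContinuousLinearMap.finiteDimensional
    haveI : ProperSpace (E →L[ℝ] E →L[ℝ] ℝ) := FiniteDimensional.proper ℝ (E →L[ℝ] E →L[ℝ] ℝ)
    exact (isCompact_closedBall (0 : E →L[ℝ] E →L[ℝ] ℝ) Λ).of_isClosed_subset
      ((Riemannian.isClosed_setOf_le_quadratic lam).inter isClosed_closedBall) inter_subset_right
  have hU : IsOpen {A : E →L[ℝ] E →L[ℝ] ℝ | A.IsInvertible} := by
    have hset : {A : E →L[ℝ] E →L[ℝ] ℝ | A.IsInvertible} =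
        range ((↑) : (E ≃L[ℝ] (E →L[ℝ] ℝ)) → E →L[ℝ] E →L[ℝ] ℝ) := by
      ext A
      simp only [mem_setOf_eq, mem_range, ContinuousLinearMap.IsInvertible]
    rw [hset]
    exact ContinuousLinearEquiv.isOpen
  have hKU : K₁ ⊆ {A : E →L[ℝ] E →L[ℝ] ℝ | A.IsInvertible} := fun A hA ↦
    Riemannian.isInvertible_of_le_quadratic hlam hA.1
  have hinv : ContDiffOn ℝ ∞ (ContinuousLinearMap.inverse : (E →L[ℝ] E →L[ℝ] ℝ) → _)
      {A : E →L[ℝ] E →L[ℝ] ℝ | A.IsInvertible} :=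
    fun A hA ↦ (ContinuousLinearMap.IsInvertible.contDiffAt_map_inverse hA).contDiffWithinAt
  have hrange : ∀ q ∈ Ω, uG q ∈ K₁ := fun q hq ↦
    ⟨fun v ↦ by
      show lam * ‖v‖ ^ 2 ≤ ((T - q.2)⁻¹ • G q.2 q.1) v v
      rw [_root_.smul_apply, _root_.smul_apply, smul_eq_mul]
      exact hpos q hq v,
     by rw [mem_closedBall, dist_zero_right]; exact hΛ q hq⟩
  -- the rates: one `ε > 0` below `δ₀` and `δ_k`, `k ≤ N`
  choose δR CR hδR hCR using hcov
  obtain ⟨ε, hε, hεδ₀, hεR⟩ := exists_pos_le_forall_le hδ₀ hδR N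
  -- order zero
  have huG0 : SpatiallyBddUpTo Ω 0 uG := spatiallyBddUpTo_zero_iff.2 ⟨hsmG.mono hΩΩ₀, Λ, hΛ⟩
  have hR0 : ∀ k ≤ N, ∀ I, SpatiallyBddUpTo Ω 0 (fun q ↦ (T - q.2) ^ (-ε) • Rc k I q) := by
    intro k hk I
    have h1 : SpatiallyBddUpTo Ω 0 (fun q ↦ (T - q.2) ^ (-δR k) • Rc k I q) :=
      spatiallyBddUpTo_zero_rpow_neg_smul ((hsmR k I).mono hΩΩ₀) htime fun q hq ↦ by
        rw [Real.norm_eq_abs]; exact hCR k q hq I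
    exact h1.rpow_neg_smul_mono hΩ (hεR k hk) htime
  have hD0 : ∀ I, SpatiallyBddUpTo Ω 0 (fun q ↦ (T - q.2) ^ (-ε) • Dc I q) := by
    intro I
    have h1 : SpatiallyBddUpTo Ω 0 (fun q ↦ (T - q.2) ^ (-δ₀) • Dc I q) := by
      refine spatiallyBddUpTo_zero_rpow_neg_smul ((hsmD I).mono hΩΩ₀) htime
        (C := C₀ * ‖b (I 0)‖ * ‖b (I 1)‖) fun q hq ↦ ?_
      have h := (ricAt (G q.2) q.1 - (2 * (T - q.2))⁻¹ • G q.2 q.1).le_opNorm₂ (b (I 0)) (b (I 1))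
      rw [_root_.sub_apply, _root_.sub_apply, _root_.smul_apply, _root_.smul_apply,
        smul_eq_mul] at h
      refine h.trans ?_
      calc ‖ricAt (G q.2) q.1 - (2 * (T - q.2))⁻¹ • G q.2 q.1‖ * ‖b (I 0)‖ * ‖b (I 1)‖
          ≤ C₀ * (T - q.2) ^ δ₀ * ‖b (I 0)‖ * ‖b (I 1)‖ := by gcongr; exact hD q hq
        _ = C₀ * ‖b (I 0)‖ * ‖b (I 1)‖ * (T - q.2) ^ δ₀ := by ring
    exact h1.rpow_neg_smul_mono hΩ hεδ₀ htime
  -- the steps of the induction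
  -- `G̃` at order `n` gives `G̃⁻¹` at order `n`
  have step_gi : ∀ n, SpatiallyBddUpTo Ω n uG → ∀ i j, SpatiallyBddUpTo Ω n (gi i j) := by
    intro n huG i j
    have h1 : SpatiallyBddUpTo Ω n (fun q ↦ ContinuousLinearMap.inverse (uG q)) :=
      huG.comp hΩ hU hK₁ hKU hinv hrange
    exact (h1.apply_const hΩ (coordCLM b j)).clm_comp hΩ (coordCLM b i)
  -- `G̃⁻¹` and the weighted `∇Ric` at order `n` give `Γ` at order `n` (integration in time)
  have step_Γ : ∀ n, (∀ i j, SpatiallyBddUpTo Ω n (gi i j)) →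
      (∀ I, SpatiallyBddUpTo Ω n (fun q ↦ (T - q.2) ^ (-ε) • Rc 0 I q)) →
      ∀ j i m', SpatiallyBddUpTo Ω n (Γc j i m') := by
    intro n hgi' hR1 j i m'
    set J₁ : ι → ι → ι → Fin 1 ⊕ Fin 2 → ι := fun p q s ↦ ocons p (pair q s) ∘ relabelOne (Fin 2)
      with hJ₁
    set v : E × ℝ → ℝ := fun q ↦ -∑ d, gi m' d q *
      ((T - q.2) ^ (-ε) • Rc 0 (J₁ j i d) q + (T - q.2) ^ (-ε) • Rc 0 (J₁ i j d) q -
        (T - q.2) ^ (-ε) • Rc 0 (J₁ d j i) q) with hv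
    have hvB : SpatiallyBddUpTo Ω n v := by
      refine (SpatiallyBddUpTo.sum hΩ Finset.univ fun d _ ↦ ?_).neg hΩ
      exact (hgi' m' d).mul hΩ (((hR1 _).add' hΩ (hR1 _)).sub hΩ (hR1 _))
    have heq : EqOn (dT (Γc j i m')) (fun q ↦ (T - q.2) ^ (ε - 1) • v q) Ω := by
      rintro ⟨y, t⟩ hq
      have hy : y ∈ V := hyV (y, t) hq
      have ht : t ∈ Ico 0 T := hIT hq.2
      have h0t : 0 < t := ht₁.1.trans_lt hq.2.1
      have hTt : 0 < T - t := hh (y, t) hq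
      have hd := (hfam.hasDerivWithinAt_chrCoef_of_flow' b hfl ht hy j i m').hasDerivAt
        (Ico_mem_nhds h0t hq.2.2)
      change deriv (fun s ↦ chrCoef (G s) b y j i m') t = _
      rw [hd.deriv]
      have hginv : ∀ d, ginv (G t) b y m' d = (T - t)⁻¹ * gi m' d (y, t) := fun d ↦ by
        have hsc : G t y = (T - t) • uG (y, t) := by
          simp only [huGdef, smul_smul, mul_inv_cancel₀ hTt.ne', one_smul]
        have hi : (uG (y, t)).IsInvertible := hKU (hrange (y, t) hq)
        rw [ginv_eq_coord_inverse, hsc, inverse_const_smul hi hTt.ne', _root_.smul_apply,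
          map_smul, smul_eq_mul]
      have hR : ∀ p q' s, tcov (G t) b (ric2 (G t) b) y (ocons p (pair q' s)) =
          (T - t) ^ ε * ((T - t) ^ (-ε) • Rc 0 (J₁ p q' s) (y, t)) := fun p q' s ↦ by
        rw [smul_eq_mul, ← mul_assoc, ← Real.rpow_add hTt, add_neg_cancel, Real.rpow_zero,
          one_mul, tcov_eq_tcovIter_one b]
      simp only [hginv, hR]
      simp only [hv]
      rw [show (T - t) ^ (ε - 1) = (T - t) ^ ε * (T - t)⁻¹ by
        rw [Real.rpow_sub_one hTt.ne', div_eq_mul_inv], smul_eq_mul, mul_neg, Finset.mul_sum]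
      congr 1
      exact Finset.sum_congr rfl fun d _ ↦ by ring
    exact spatiallyBddUpTo_of_dT_rpow hB₀ hB (isCompact_closedBall y₀ r') ball_subset_closedBall
      hcB ht₁.2 hε (hsmΓ j i m') hvB heq
  -- `Γ` at order `n`, weighted `∇ᵏ⁺²Ric`, `∇ᵏ⁺¹Ric` at order `n` give weighted `∇ᵏ⁺¹Ric` at `n + 1`
  have step_R : ∀ n, (∀ j i m', SpatiallyBddUpTo Ω n (Γc j i m')) →
      ∀ k, (∀ I, SpatiallyBddUpTo Ω n (fun q ↦ (T - q.2) ^ (-ε) • Rc (k + 1) I q)) →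
      (∀ I, SpatiallyBddUpTo Ω n (fun q ↦ (T - q.2) ^ (-ε) • Rc k I q)) →
      (∀ I, SpatiallyBddUpTo Ω 0 (fun q ↦ (T - q.2) ^ (-ε) • Rc k I q)) →
      ∀ I, SpatiallyBddUpTo Ω (n + 1) (fun q ↦ (T - q.2) ^ (-ε) • Rc k I q) := by
    intro n hΓ k hRk1 hRk hRk0 I
    refine (hRk0 I).of_dY ?_
    refine SpatiallyBddUpTo.dY_of_basis hΩ b fun j ↦ ?_
    set w : E × ℝ → ℝ := fun q ↦
      (T - q.2) ^ (-ε) • Rc (k + 1) (ocons j I ∘ ⇑(shiftEquiv (k + 1) (Fin 2)).symm) q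
      + ∑ a, ∑ m, Γc j (I a) m q * ((T - q.2) ^ (-ε) • Rc k (update I a m) q) with hw
    have hwB : SpatiallyBddUpTo Ω n w :=
      (hRk1 _).add' hΩ (SpatiallyBddUpTo.sum hΩ Finset.univ fun a _ ↦
        SpatiallyBddUpTo.sum hΩ Finset.univ fun m _ ↦ (hΓ _ _ _).mul hΩ (hRk _))
    refine hwB.congr hΩ fun q hq ↦ ?_
    have hd : DifferentiableAt ℝ (fun y ↦ Rc k I (y, q.2)) q.1 :=
      (contDiffAt_sliceY hΩ₀ (hsmR k I) (hΩΩ₀ hq)).differentiableAt (by simp)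
    rw [dY_tsmul (u := Rc k I) (fun s ↦ (T - s) ^ (-ε)) hd, _root_.smul_apply]
    change w q = (T - q.2) ^ (-ε) •
      fderiv ℝ (fun y ↦ tcovIter (G q.2) b (k + 1) (ric2 (G q.2) b) y I) q.1 (b j)
    rw [fderiv_tcovIter_apply, hw]
    simp only [hRc, hΓc, smul_eq_mul]
    rw [mul_add, Finset.mul_sum]
    congr 1
    refine Finset.sum_congr rfl fun a _ ↦ ?_
    rw [Finset.mul_sum]
    exact Finset.sum_congr rfl fun m _ ↦ by ring
  -- `G̃` and `Γ` at order `n` give `G̃` at order `n + 1`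
  have step_G : ∀ n, SpatiallyBddUpTo Ω n uG → (∀ j i m', SpatiallyBddUpTo Ω n (Γc j i m')) →
      SpatiallyBddUpTo Ω (n + 1) uG := by
    intro n huG hΓ
    have hgc : ∀ j l, SpatiallyBddUpTo Ω n (fun q ↦ uG q (b j) (b l)) := fun j l ↦
      (huG.apply_const hΩ (b j)).apply_const hΩ (b l)
    refine (huG.mono (Nat.zero_le _)).of_dY ?_
    refine SpatiallyBddUpTo.dY_of_basis hΩ b fun i ↦ ?_
    have hcomp : ∀ j l, SpatiallyBddUpTo Ω n (fun q ↦ dY uG q (b i) (b j) (b l)) := by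
      intro j l
      set w : E × ℝ → ℝ := fun q ↦ ∑ m, (Γc i j m q * uG q (b m) (b l) + Γc i l m q * uG q (b j) (b m))
        with hw
      have hwB : SpatiallyBddUpTo Ω n w :=
        SpatiallyBddUpTo.sum hΩ Finset.univ fun m _ ↦
          ((hΓ _ _ _).mul hΩ (hgc _ _)).add' hΩ ((hΓ _ _ _).mul hΩ (hgc _ _))
      refine hwB.congr hΩ fun q hq ↦ ?_
      have hd : DifferentiableAt ℝ (fun y ↦ G q.2 y) q.1 := (hmet q hq).differentiableAt (hyV q hq)
      have h1 : dY uG q = (T - q.2)⁻¹ • dY (fun p : E × ℝ ↦ G p.2 p.1) q :=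
        dY_tsmul (u := fun p : E × ℝ ↦ G p.2 p.1) (fun s ↦ (T - s)⁻¹) hd
      rw [h1, _root_.smul_apply, _root_.smul_apply, _root_.smul_apply, smul_eq_mul]
      change w q = (T - q.2)⁻¹ * fderiv ℝ (G q.2) q.1 (b i) (b j) (b l)
      rw [← (hmet q hq).fderiv_apply₂ (hyV q hq) (b j) (b l) (b i),
        (hmet q hq).fderiv_metric_apply_basis (hyV q hq) i j l, hw]
      simp only [hΓc, huGdef, _root_.smul_apply, smul_eq_mul]
      rw [Finset.mul_sum]
      exact Finset.sum_congr rfl fun m _ ↦ by ring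
    -- reconstruct `∂_i G̃` from its components
    have hsum := SpatiallyBddUpTo.sum hΩ Finset.univ fun j _ ↦ SpatiallyBddUpTo.sum hΩ Finset.univ
      fun l _ ↦ (hcomp j l).smul_const hΩ
        ((ContinuousLinearMap.mul ℝ ℝ).bilinearComp (coordCLM b j) (coordCLM b l))
    refine hsum.congr hΩ fun q _ ↦ ?_
    exact (eq_sum_apply_basis_smul b (dY uG q (b i))).symm
  -- `Γ`, weighted `∇Ric` and weighted defect at order `n` give the weighted defect at `n + 1`
  have step_D : ∀ n, (∀ j i m', SpatiallyBddUpTo Ω n (Γc j i m')) →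
      (∀ I, SpatiallyBddUpTo Ω n (fun q ↦ (T - q.2) ^ (-ε) • Rc 0 I q)) →
      (∀ I, SpatiallyBddUpTo Ω n (fun q ↦ (T - q.2) ^ (-ε) • Dc I q)) →
      ∀ I, SpatiallyBddUpTo Ω (n + 1) (fun q ↦ (T - q.2) ^ (-ε) • Dc I q) := by
    intro n hΓ hR1 hDn I
    refine (hD0 I).of_dY ?_
    refine SpatiallyBddUpTo.dY_of_basis hΩ b fun j ↦ ?_
    set w : E × ℝ → ℝ := fun q ↦ (T - q.2) ^ (-ε) • Rc 0 (ocons j I ∘ relabelOne (Fin 2)) q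
      + ∑ a, ∑ m, Γc j (I a) m q * ((T - q.2) ^ (-ε) • Dc (update I a m) q) with hw
    have hwB : SpatiallyBddUpTo Ω n w :=
      (hR1 _).add' hΩ (SpatiallyBddUpTo.sum hΩ Finset.univ fun a _ ↦
        SpatiallyBddUpTo.sum hΩ Finset.univ fun m _ ↦ (hΓ _ _ _).mul hΩ (hDn _))
    refine hwB.congr hΩ fun q hq ↦ ?_
    have hd : DifferentiableAt ℝ (fun y ↦ Dc I (y, q.2)) q.1 :=
      (contDiffAt_sliceY hΩ₀ (hsmD I) (hΩΩ₀ hq)).differentiableAt (by simp)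
    rw [dY_tsmul (u := Dc I) (fun s ↦ (T - s) ^ (-ε)) hd, _root_.smul_apply]
    change w q = (T - q.2) ^ (-ε) • fderiv ℝ (fun y ↦ ric2 (G q.2) b y I
      - (2 * (T - q.2))⁻¹ * G q.2 y (b (I 0)) (b (I 1))) q.1 (b j)
    rw [(hmet q hq).fderiv_ric2_sub_apply_basis (hyV q hq), tcov_eq_tcovIter_one b,
      show tcovIter (G q.2) b 1 (ric2 (G q.2) b) q.1 (ocons j I ∘ relabelOne (Fin 2)) =
        Rc 0 (ocons j I ∘ relabelOne (Fin 2)) q from rfl, hw]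
    simp only [hΓc, hDc, smul_eq_mul]
    rw [mul_add, Finset.mul_sum]
    congr 1
    refine Finset.sum_congr rfl fun a _ ↦ ?_
    rw [Finset.mul_sum]
    exact Finset.sum_congr rfl fun m _ ↦ by ring
  -- the induction on the order `n ≤ N`
  have key : ∀ n ≤ N, SpatiallyBddUpTo Ω n uG ∧ (∀ j i m', SpatiallyBddUpTo Ω n (Γc j i m')) ∧
      (∀ k, k + n ≤ N → ∀ I, SpatiallyBddUpTo Ω n (fun q ↦ (T - q.2) ^ (-ε) • Rc k I q)) ∧
      (∀ I, SpatiallyBddUpTo Ω n (fun q ↦ (T - q.2) ^ (-ε) • Dc I q)) := by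
    intro n
    induction n with
    | zero =>
      intro _
      have hR : ∀ k, k + 0 ≤ N → ∀ I,
          SpatiallyBddUpTo Ω 0 (fun q ↦ (T - q.2) ^ (-ε) • Rc k I q) :=
        fun k hk I ↦ hR0 k (by omega) I
      exact ⟨huG0, step_Γ 0 (step_gi 0 huG0) (hR 0 (by omega)), hR, hD0⟩
    | succ n ih =>
      intro hn
      obtain ⟨huG, hΓ, hR, hDn⟩ := ih (by omega)
      have hR' : ∀ k, k + (n + 1) ≤ N → ∀ I,
          SpatiallyBddUpTo Ω (n + 1) (fun q ↦ (T - q.2) ^ (-ε) • Rc k I q) := fun k hk I ↦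
        step_R n hΓ k (hR (k + 1) (by omega)) (hR k (by omega)) (hR0 k (by omega)) I
      have huG' := step_G n huG hΓ
      exact ⟨huG', step_Γ (n + 1) (step_gi (n + 1) huG') (hR' 0 (by omega)), hR',
        step_D n hΓ (hR 0 (by omega)) hDn⟩
  obtain ⟨huG, -, -, hDN⟩ := key N le_rfl
  exact ⟨ε, hε, huG, hDN⟩

end MetricCoord

end Literature.Geometry.Lorentzian

end
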